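import Mathlib
import HarnessLib

/-!
# The decoupling lemma, the sandwich theorem and convex subdifferential calculus

Literature anchor for J. M. Borwein and Q. J. Zhu, *Techniques of Variational Analysis*
(CMS Books in Mathematics, Springer, 2005), Chapter 4, **§4.3 "Sandwich Theorems and Calculus"**,
pp. 127–133 [cite: BorweinZhu2005, §4.3 pp. 127–133].

## Content

* `decoupling` — **Lemma 4.3.1 (Decoupling Lemma)** under the interior-point constraint
  qualification (4.3.2) `A dom f ∩ cont g ≠ ∅`: there is `y* ∈ Y*` with
  `p ≤ [f(x) − ⟨y*, Ax⟩] + [g(y) + ⟨y*, y⟩]` for all `x`, `y` — (4.3.3);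
* `sandwich` — **Theorem 4.3.2 (Sandwich Theorem)**: if `f ≥ −g ∘ A` then an affine function
  `α(x) = ⟨A*y*, x⟩ + r` satisfies `f ≥ α ≥ −g ∘ A`, and `−y* ∈ ∂g(Ax̄)` whenever
  `f(x̄) = −g(Ax̄)`;
* `subdiff_add_comp_subset` / `subdiff_sum_rule` / `subdiff_add_comp_eq` — **Theorem 4.3.3
  (Convex Subdifferential Sum Rule)**: `∂(f + g ∘ A)(x) ⊇ ∂f(x) + A*∂g(Ax)` (4.3.9) always, with
  equality (4.3.8) under (4.3.2);
* `normalCone_inter` — **Theorem 4.3.4 (Normals to an Intersection)**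
  `N(C₁ ∩ C₂; x) = N(C₁; x) + N(C₂; x)` when `C₁ ∩ int C₂ ≠ ∅` (= Exercise 4.3.6);
* `exists_affine_minorant_of_mem_nhds`, `exists_affine_minorant_of_continuousAt`,
  `isMinOn_of_subgradient`, `exists_subgradient_of_isMinOn_of_mem_nhds`,
  `exists_subgradient_of_isMinOn_of_continuousAt` — **Theorem 4.3.6 (Pshenichnii–Rockafellar
  Conditions)** for the convex programme `CP : minimize f(x) subject to x ∈ C` (4.3.14): an affine
  minorant `α ≤ f` with `inf_C α = inf_C f`, and `x̄` solves `CP` iff `0 ∈ ∂f(x̄) + N(C; x̄)`, under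
  either qualification `C ∩ cont f ≠ ∅` or `int C ∩ dom f ≠ ∅` (= Exercise 4.3.7);
* `hahnBanach_of_sandwich` — **Theorem 4.3.7 (Hahn–Banach Extension)** deduced from the sandwich
  theorem (= Exercise 4.3.9);
* `separation` — **Theorem 4.3.8 (Separation Theorem)** (= Exercise 4.3.10);
* `sum_rule_fails_without_qualification` — **Exercise 4.3.12 (i)**: convex `f, g` on `ℝ` with
  `∂f(0) + ∂g(0) ≠ ∂(f + g)(0)`.

## Conventions and deviations from the text

(i) *Functions.* As in the other anchors of this chapter, an extended-valued convex function
`f : X → ℝ ∪ {+∞}` of the book is a real function `f : X → ℝ` together with its effective domain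
`Df : Set X`, convexity being Mathlib's `ConvexOn ℝ Df f`; values of `f` off `Df` are irrelevant.
The dual `X*` is `X →L[ℝ] ℝ` and `A* y* = y*.comp A`.

(ii) *Subdifferentials and normal cones are written out.* `x* ∈ ∂f(x̄)` is the inequality (4.2.1)
`∀ x ∈ Df, x*(x − x̄) ≤ f(x) − f(x̄)` and `x* ∈ N(C; x̄) = ∂ι_C(x̄)` is `∀ c ∈ C, x*(c − x̄) ≤ 0`;
these are literally the memberships `x* ∈ convexSubdiff Df f x̄`, `x* ∈ convexNormalCone C x̄` of
the tree file `Literature/Analysis/Convex/ConvexSubdifferentialMaxFormula.lean` (§4.2), which is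
not imported here so that this file depends on Mathlib only.  In Theorem 4.3.4 the three normal
cones are the corresponding sets of functionals and `+` is pointwise set addition.

(iii) *Constraint qualification.* Only the interior-point condition (4.3.2) is treated, in the
form `∃ x₀ ∈ Df, Dg ∈ 𝓝 (A x₀) ∧ ContinuousAt g (A x₀)`; the alternative (4.3.1)
`0 ∈ core (dom g − A dom f)` for lsc data rests on cs-closed sets and Baire category (§4.1.3 of
the book, tree file `ConvexSeriesClosed.lean`) and is not formalised here.  Accordingly `X` and
`Y` are arbitrary real normed spaces — completeness is never used (compare Exercise 4.3.3).

(iv) *Proof of Lemma 4.3.1.* The book obtains `−y* ∈ ∂h(0)` for the optimal value function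
`h(u) = inf_x {f(x) + g(Ax + u)}` from Theorem 4.2.8.  We instead separate the convex set
`S = {(u, r) | ∃ x ∈ Df, Ax + u ∈ Dg, f(x) + g(Ax + u) < r} ⊆ Y × ℝ` (the strict epigraph of `h`),
which has non-empty interior by (4.3.2), from the ray `{0} × (−∞, p]` with Mathlib's geometric
Hahn–Banach theorem `geometric_hahn_banach_open`; the vertical component of the separating
functional is shown to be negative and normalising it gives `y*`.  The number `p` may be ANY lower
bound of `f + g ∘ A` on `Df ∩ A⁻¹ Dg`: for `p = inf (f + g ∘ A)` this is (4.3.3) verbatim, a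
smaller `p` gives a weaker inequality, and when `f + g ∘ A` is unbounded below the lemma is void,
as in the book (`p = −∞`).

(v) *Theorem 4.3.6* is stated for an arbitrary lower bound `p` of `f` on `C` (conclusion:
`α ≤ f` on `dom f` and `α ≥ p` on `C`; for `p = inf_C f` this is `inf_C α = inf_C f`, since
`α ≤ f` forces `inf_C α ≤ inf_C f`).  Closedness of `C` is not needed and not assumed.

(vi) *Theorem 4.3.7* is stated for a continuous sublinear `p` (subadditive and positively
homogeneous) and a linear functional `h` on a subspace `L` dominated by `p`; Mathlib has the
independent algebraic version `exists_extension_of_le_sublinear` — the point here is the book's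
deduction from the sandwich theorem (with the roles of the two functions exchanged so that
(4.3.2) applies to the everywhere-continuous `p`).

(vii) *Theorem 4.3.8* as printed ("there exists an affine function `α` with
`sup_{C₁} α ≤ inf_{C₂} α`") is satisfied by a constant `α`; we state the intended conclusion with
a NON-ZERO continuous linear functional, which requires `C₂ ≠ ∅`, and prove it directly from
`geometric_hahn_banach_open` applied to `int C₁` and `C₂` (the same tool that proves Lemma 4.3.1
here), extending to `C₁ ⊆ cl (int C₁)`.

## Not formalised

Theorem 4.3.5 (convex multidirectional mean value inequality; it rests on the Ekeland variational
principle of §2.1), the core qualification (4.3.1) (see (iii)), Exercises 4.3.1–4.3.3, 4.3.5,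
4.3.8, 4.3.11, 4.3.12 (ii), 4.3.13.

## Related material (not imported)

Mathlib: `geometric_hahn_banach_*` (separation of convex sets), `exists_extension_of_le_sublinear`
and `riesz_extension` (algebraic Hahn–Banach), `ConvexOn`; no subdifferential calculus.  Tree:
`Literature/Analysis/Convex/ConvexSubdifferentialMaxFormula.lean` (§4.2: `convexSubdiff`,
`convexNormalCone`, max formula Theorem 4.2.8), `Literature/Analysis/Convex/FenchelConjugate.lean`
(§4.4: Fenchel duality Theorem 4.4.3 is proved there from the decoupling inequality (4.3.3) taken
as a hypothesis — `decoupling` below discharges that hypothesis under (4.3.2)).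
-/

open Set Filter Topology Pointwise

namespace Literature.Analysis.Convex.ConvexSandwichTheorem

variable {X Y : Type*} [NormedAddCommGroup X] [NormedSpace ℝ X]
  [NormedAddCommGroup Y] [NormedSpace ℝ Y]

section Decoupling

variable {f : X → ℝ} {Df : Set X} {g : Y → ℝ} {Dg : Set Y}

/-- The strict epigraph of the optimal value function `h(u) = inf_x {f(x) + g(Ax + u)}` of the
proof of Lemma 4.3.1: `{(u, r) | ∃ x ∈ dom f, Ax + u ∈ dom g, f(x) + g(Ax + u) < r}`. [folklore] -/
private def pertSet (f : X → ℝ) (Df : Set X) (g : Y → ℝ) (Dg : Set Y) (A : X →L[ℝ] Y) :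
    Set (Y × ℝ) :=
  {q | ∃ x ∈ Df, A x + q.1 ∈ Dg ∧ f x + g (A x + q.1) < q.2}

/-- Membership in `pertSet`. [folklore] -/
private theorem mem_pertSet_iff {A : X →L[ℝ] Y} {q : Y × ℝ} :
    q ∈ pertSet f Df g Dg A ↔ ∃ x ∈ Df, A x + q.1 ∈ Dg ∧ f x + g (A x + q.1) < q.2 :=
  Iff.rfl

/-- The strict epigraph of the value function is convex. [folklore] -/
private theorem convex_pertSet (hf : ConvexOn ℝ Df f) (hg : ConvexOn ℝ Dg g) (A : X →L[ℝ] Y) :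
    Convex ℝ (pertSet f Df g Dg A) := by
  rintro ⟨u₁, r₁⟩ ⟨x₁, hx₁, hd₁, h₁⟩ ⟨u₂, r₂⟩ ⟨x₂, hx₂, hd₂, h₂⟩ a b ha hb hab
  have heq : A (a • x₁ + b • x₂) + (a • (u₁, r₁) + b • (u₂, r₂)).1 =
      a • (A x₁ + u₁) + b • (A x₂ + u₂) := by
    simp only [map_add, map_smul, Prod.fst_add, Prod.smul_fst, smul_add]
    abel
  refine ⟨a • x₁ + b • x₂, hf.1 hx₁ hx₂ ha hb hab, ?_, ?_⟩
  · rw [heq]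
    exact hg.1 hd₁ hd₂ ha hb hab
  · rw [heq]
    have hf' := hf.2 hx₁ hx₂ ha hb hab
    have hg' := hg.2 hd₁ hd₂ ha hb hab
    simp only [smul_eq_mul] at hf' hg'
    simp only [Prod.snd_add, Prod.smul_snd, smul_eq_mul]
    have hm : 0 < a * (r₁ - (f x₁ + g (A x₁ + u₁))) + b * (r₂ - (f x₂ + g (A x₂ + u₂))) := by
      have h1' := sub_pos.2 h₁
      have h2' := sub_pos.2 h₂
      rcases ha.eq_or_lt with rfl | ha'
      · rw [zero_add] at hab
        rw [hab, zero_mul, one_mul, zero_add]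
        exact h2'
      · exact add_pos_of_pos_of_nonneg (mul_pos ha' h1') (mul_nonneg hb h2'.le)
    linarith

/-- **Lemma 4.3.1 (Decoupling Lemma)**, under the constraint qualification (4.3.2)
`A dom f ∩ cont g ≠ ∅`.  Let `f` be convex on `Df ⊆ X`, `g` convex on `Dg ⊆ Y`, `A : X → Y`
bounded linear, and suppose `g` is continuous at `A x₀` for some `x₀ ∈ dom f` with `dom g` a
neighbourhood of `A x₀`.  If `p` is a lower bound of `f(x) + g(Ax)` over `x ∈ dom f ∩ A⁻¹ dom g`
(in the book, `p = inf_X {f(x) + g(Ax)}`), then there is `y* ∈ Y*` such that for all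
`x ∈ dom f` and `y ∈ dom g`,
`p ≤ [f(x) − ⟨y*, Ax⟩] + [g(y) + ⟨y*, y⟩]` — inequality (4.3.3).
[cite: BorweinZhu2005, Lemma 4.3.1 p. 127] -/
theorem decoupling (hf : ConvexOn ℝ Df f) (hg : ConvexOn ℝ Dg g) (A : X →L[ℝ] Y) {x₀ : X}
    (hx₀ : x₀ ∈ Df) (hDg : Dg ∈ 𝓝 (A x₀)) (hgc : ContinuousAt g (A x₀)) {p : ℝ}
    (hp : ∀ x ∈ Df, A x ∈ Dg → p ≤ f x + g (A x)) :
    ∃ ys : Y →L[ℝ] ℝ, ∀ x ∈ Df, ∀ y ∈ Dg, p ≤ (f x - ys (A x)) + (g y + ys y) := by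
  have hSc : Convex ℝ (pertSet f Df g Dg A) := convex_pertSet hf hg A
  -- a neighbourhood of `A x₀` inside `dom g` on which `g < g (A x₀) + 1`
  obtain ⟨δ, hδ, hball⟩ :
      ∃ δ > 0, ∀ y, dist y (A x₀) < δ → y ∈ Dg ∧ g y < g (A x₀) + 1 := by
    have h2 : ∀ᶠ y in 𝓝 (A x₀), g y < g (A x₀) + 1 :=
      hgc.eventually (eventually_lt_nhds (by linarith))
    have h1 : ∀ᶠ y in 𝓝 (A x₀), y ∈ Dg := hDg
    obtain ⟨δ, hδ, h⟩ := Metric.eventually_nhds_iff.1 (h1.and h2)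
    exact ⟨δ, hδ, fun y hy => h hy⟩
  set M : ℝ := f x₀ + g (A x₀) + 1 with hM
  -- an open box inside the strict epigraph: its interior is non-empty
  have hU : Metric.ball (0 : Y) δ ×ˢ Ioi M ⊆ pertSet f Df g Dg A := by
    rintro ⟨u, r⟩ ⟨hu, hr⟩
    rw [Metric.mem_ball, dist_zero_right] at hu
    have hy : dist (A x₀ + u) (A x₀) < δ := by simpa [dist_eq_norm] using hu
    obtain ⟨hyD, hyg⟩ := hball _ hy
    rw [mem_Ioi] at hr
    exact ⟨x₀, hx₀, hyD, by linarith⟩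
  have hM1 : ((0 : Y), M + 1) ∈ interior (pertSet f Df g Dg A) :=
    interior_maximal hU (Metric.isOpen_ball.prod isOpen_Ioi)
      ⟨Metric.mem_ball_self hδ, show M < M + 1 by linarith⟩
  -- the ray `{0} × (-∞, p]` misses the strict epigraph
  have hTc : Convex ℝ (({0} : Set Y) ×ˢ Iic p) := (convex_singleton _).prod (convex_Iic _)
  have hdisj : Disjoint (interior (pertSet f Df g Dg A)) (({0} : Set Y) ×ˢ Iic p) := by
    refine Set.disjoint_left.2 fun q hqS hqT => ?_
    obtain ⟨x, hx, hxD, hlt⟩ := interior_subset hqS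
    obtain ⟨hq1, hq2⟩ := hqT
    rw [mem_singleton_iff] at hq1
    rw [hq1, add_zero] at hxD hlt
    rw [mem_Iic] at hq2
    linarith [hp x hx hxD]
  obtain ⟨φ, u, hφS, hφT⟩ := geometric_hahn_banach_open hSc.interior isOpen_interior hTc hdisj
  -- the separation extends to the whole strict epigraph
  have hφS' : ∀ q ∈ pertSet f Df g Dg A, φ q ≤ u := by
    intro q hq
    have hcl : q ∈ closure (interior (pertSet f Df g Dg A)) := by
      rw [hSc.closure_interior_eq_closure_of_nonempty_interior ⟨_, hM1⟩]
      exact subset_closure hq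
    exact closure_minimal (t := {a | φ a ≤ u}) (fun a ha => (hφS a ha).le)
      (isClosed_le φ.continuous continuous_const) hcl
  -- decompose `φ (v, r) = ψ v + r c`
  set c : ℝ := φ (0, 1) with hc_def
  set ψ : Y →L[ℝ] ℝ := φ.comp (ContinuousLinearMap.inl ℝ Y ℝ) with hψ_def
  have hφ : ∀ (v : Y) (r : ℝ), φ (v, r) = ψ v + r * c := by
    intro v r
    have : ((v, r) : Y × ℝ) = (v, 0) + r • ((0 : Y), (1 : ℝ)) := by ext <;> simp
    rw [this, map_add, map_smul, smul_eq_mul]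
    rfl
  have hup : u ≤ p * c := by
    have := hφT (0, p) (by simp)
    rwa [hφ, map_zero, zero_add] at this
  -- the vertical component is negative
  have hc : c < 0 := by
    have h1 : φ (0, M + 1) < u := hφS _ hM1
    rw [hφ, map_zero, zero_add] at h1
    have hpM : p ≤ M - 1 := by
      have := hp x₀ hx₀ (hball _ (by simpa using hδ)).1
      linarith
    by_contra hcn
    push Not at hcn
    have := mul_le_mul_of_nonneg_right hpM hcn
    linarith
  have hc0 : c ≠ 0 := hc.ne
  refine ⟨c⁻¹ • ψ, fun x hx y hy => ?_⟩
  have key : ∀ r : ℝ, f x + g y < r → p ≤ r + c⁻¹ * ψ (y - A x) := by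
    intro r hr
    have hmem : ((y - A x, r) : Y × ℝ) ∈ pertSet f Df g Dg A :=
      mem_pertSet_iff.2 ⟨x, hx, by simpa using hy, by simpa using hr⟩
    have h1 := hφS' _ hmem
    rw [hφ] at h1
    have h2 : ψ (y - A x) + r * c ≤ p * c := h1.trans hup
    calc p ≤ (ψ (y - A x) + r * c) / c := (le_div_iff_of_neg hc).2 h2
      _ = r + c⁻¹ * ψ (y - A x) := by field_simp; ring
  have hle : p ≤ f x + g y + c⁻¹ * ψ (y - A x) :=
    le_of_forall_gt_imp_ge_of_dense fun a ha => by
      have := key (a - c⁻¹ * ψ (y - A x)) (by linarith)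
      linarith
  rw [map_sub, mul_sub] at hle
  simp only [smul_apply, smul_eq_mul]
  linarith

/-- **Theorem 4.3.2 (Sandwich Theorem)**, under (4.3.2).  If `f ≥ −g ∘ A` (on
`dom f ∩ A⁻¹ dom g`, the inequality being trivial elsewhere), there is an affine function
`α(x) = ⟨A* y*, x⟩ + r = ⟨y*, Ax⟩ + r` with `f ≥ α` on `dom f` and `α ≥ −g ∘ A` on `A⁻¹ dom g`.
Moreover, for any `x̄` with `f(x̄) = −g(Ax̄)` one has `−y* ∈ ∂g(Ax̄)`, i.e.
`⟨−y*, y − Ax̄⟩ ≤ g(y) − g(Ax̄)` for all `y ∈ dom g`.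
[cite: BorweinZhu2005, Thm 4.3.2 p. 128] -/
theorem sandwich (hf : ConvexOn ℝ Df f) (hg : ConvexOn ℝ Dg g) (A : X →L[ℝ] Y) {x₀ : X}
    (hx₀ : x₀ ∈ Df) (hDg : Dg ∈ 𝓝 (A x₀)) (hgc : ContinuousAt g (A x₀))
    (hfg : ∀ x ∈ Df, A x ∈ Dg → -g (A x) ≤ f x) :
    ∃ (ys : Y →L[ℝ] ℝ) (r : ℝ), (∀ x ∈ Df, ys (A x) + r ≤ f x) ∧
      (∀ z : X, A z ∈ Dg → -g (A z) ≤ ys (A z) + r) ∧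
      ∀ x' ∈ Df, A x' ∈ Dg → f x' = -g (A x') →
        ∀ y ∈ Dg, -(ys (y - A x')) ≤ g y - g (A x') := by
  obtain ⟨ys, hys⟩ := decoupling hf hg A hx₀ hDg hgc (p := 0)
    (fun x hx hAx => by linarith [hfg x hx hAx])
  have hA0 : A x₀ ∈ Dg := mem_of_mem_nhds hDg
  -- `b := sup_z [-g(Az) - ⟨y*, Az⟩] ≤ a := inf_x [f(x) - ⟨y*, Ax⟩]`; take `r := b`
  set B : Set ℝ := (fun z : X => -g (A z) - ys (A z)) '' {z | A z ∈ Dg} with hB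
  have hBne : B.Nonempty := ⟨_, x₀, hA0, rfl⟩
  have hBle : ∀ x ∈ Df, ∀ b ∈ B, b ≤ f x - ys (A x) := by
    rintro x hx _ ⟨z, hz, rfl⟩
    have := hys x hx (A z) hz
    linarith
  have hBbdd : BddAbove B := ⟨f x₀ - ys (A x₀), fun b hb => hBle x₀ hx₀ b hb⟩
  refine ⟨ys, sSup B, fun x hx => ?_, fun z hz => ?_, fun x' hx' _ _ y hy => ?_⟩
  · have : sSup B ≤ f x - ys (A x) := csSup_le hBne (hBle x hx)
    linarith
  · have : -g (A z) - ys (A z) ≤ sSup B := le_csSup hBbdd ⟨z, hz, rfl⟩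
    linarith
  · have := hys x' hx' y hy
    rw [map_sub]
    linarith

/-- **Theorem 4.3.3**, inclusion (4.3.9) `∂(f + g ∘ A)(x̄) ⊇ ∂f(x̄) + A* ∂g(Ax̄)` (no qualification
needed; = Exercise 4.3.4 (i)): if `x₁* ∈ ∂f(x̄)` and `y* ∈ ∂g(Ax̄)` then `x₁* + A* y*` is a
subgradient of `f + g ∘ A` (effective domain `dom f ∩ A⁻¹ dom g`) at `x̄`.
[cite: BorweinZhu2005, Thm 4.3.3 (4.3.9) p. 129 & Exercise 4.3.4 p. 133] -/
theorem subdiff_add_comp_subset (A : X →L[ℝ] Y) {x' : X} {xs₁ : X →L[ℝ] ℝ} {ys : Y →L[ℝ] ℝ}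
    (h₁ : ∀ x ∈ Df, xs₁ (x - x') ≤ f x - f x') (h₂ : ∀ y ∈ Dg, ys (y - A x') ≤ g y - g (A x')) :
    ∀ x ∈ Df, A x ∈ Dg → (xs₁ + ys.comp A) (x - x') ≤ f x + g (A x) - (f x' + g (A x')) := by
  intro x hx hAx
  have e₁ := h₁ x hx
  have e₂ := h₂ (A x) hAx
  rw [← map_sub] at e₂
  simp only [add_apply, ContinuousLinearMap.comp_apply]
  linarith

/-- **Theorem 4.3.3 (Convex Subdifferential Sum Rule)**, equality under (4.3.2): if
`x* ∈ ∂(f + g ∘ A)(x̄)` (with `x̄ ∈ dom f ∩ A⁻¹ dom g`), there is `y* ∈ ∂g(Ax̄)` with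
`x* − A* y* ∈ ∂f(x̄)`; that is `x* ∈ ∂f(x̄) + A* ∂g(Ax̄)`.  Proof as in the book, from the
sandwich theorem applied to `x ↦ f(x) − f(x̄) − ⟨x*, x − x̄⟩` and `y ↦ g(y) − g(Ax̄)`.
[cite: BorweinZhu2005, Thm 4.3.3 p. 129 & Exercise 4.3.4 p. 133] -/
theorem subdiff_sum_rule (hf : ConvexOn ℝ Df f) (hg : ConvexOn ℝ Dg g) (A : X →L[ℝ] Y) {x₀ : X}
    (hx₀ : x₀ ∈ Df) (hDg : Dg ∈ 𝓝 (A x₀)) (hgc : ContinuousAt g (A x₀)) {x' : X} (hx' : x' ∈ Df)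
    (hAx' : A x' ∈ Dg) {xs : X →L[ℝ] ℝ}
    (hxs : ∀ x ∈ Df, A x ∈ Dg → xs (x - x') ≤ f x + g (A x) - (f x' + g (A x'))) :
    ∃ ys : Y →L[ℝ] ℝ, (∀ y ∈ Dg, ys (y - A x') ≤ g y - g (A x')) ∧
      ∀ x ∈ Df, (xs - ys.comp A) (x - x') ≤ f x - f x' := by
  set f' : X → ℝ := fun x => f x - f x' - xs (x - x') with hf'_def
  set g' : Y → ℝ := fun y => g y - g (A x') with hg'_def
  have hf'c : ConvexOn ℝ Df f' := by
    refine ⟨hf.1, fun x hx y hy a b ha hb hab => ?_⟩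
    have h := hf.2 hx hy ha hb hab
    simp only [hf'_def, smul_eq_mul, map_sub, map_add, map_smul] at h ⊢
    have e1 : a * f x' + b * f x' = f x' := by rw [← add_mul, hab, one_mul]
    have e2 : a * xs x' + b * xs x' = xs x' := by rw [← add_mul, hab, one_mul]
    linarith
  have hg'c : ConvexOn ℝ Dg g' := by
    refine ⟨hg.1, fun x hx y hy a b ha hb hab => ?_⟩
    have h := hg.2 hx hy ha hb hab
    simp only [hg'_def, smul_eq_mul] at h ⊢
    have e1 : a * g (A x') + b * g (A x') = g (A x') := by rw [← add_mul, hab, one_mul]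
    linarith
  have hgc' : ContinuousAt g' (A x₀) := hgc.sub continuousAt_const
  have hfg' : ∀ x ∈ Df, A x ∈ Dg → -g' (A x) ≤ f' x := by
    intro x hx hAx
    have := hxs x hx hAx
    simp only [hf'_def, hg'_def]
    linarith
  obtain ⟨ys, r, h1, h2, h3⟩ := sandwich hf'c hg'c A hx₀ hDg hgc' hfg'
  have hz1 : f' x' = 0 := by simp [hf'_def]
  have hz2 : g' (A x') = 0 := by simp [hg'_def]
  have hr1 : ys (A x') + r ≤ 0 := hz1 ▸ h1 x' hx'
  have hr2 : 0 ≤ ys (A x') + r := by have := h2 x' hAx'; rw [hz2, neg_zero] at this; exact this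
  refine ⟨-ys, fun y hy => ?_, fun x hx => ?_⟩
  · have := h3 x' hx' hAx' (by rw [hz1, hz2, neg_zero]) y hy
    simp only [hg'_def, sub_self, sub_zero] at this
    simpa using this
  · have e1 := h1 x hx
    simp only [hf'_def, map_sub] at e1
    simp only [sub_apply, neg_apply, ContinuousLinearMap.comp_apply, map_sub, sub_neg_eq_add]
    linarith

/-- **Theorem 4.3.3** in the set form (4.3.8): under (4.3.2), for `x̄ ∈ dom f ∩ A⁻¹ dom g`,
`∂(f + g ∘ A)(x̄) = ∂f(x̄) + A* ∂g(Ax̄)`, all three subdifferentials being the sets of functionals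
satisfying the subgradient inequality (4.2.1) on the respective domains, `A* ∂g(Ax̄)` the image
of `∂g(Ax̄)` under `y* ↦ y* ∘ A`, and `+` the pointwise sum of sets.
[cite: BorweinZhu2005, Thm 4.3.3 (4.3.8) p. 129] -/
theorem subdiff_add_comp_eq (hf : ConvexOn ℝ Df f) (hg : ConvexOn ℝ Dg g) (A : X →L[ℝ] Y)
    {x₀ : X} (hx₀ : x₀ ∈ Df) (hDg : Dg ∈ 𝓝 (A x₀)) (hgc : ContinuousAt g (A x₀)) {x' : X}
    (hx' : x' ∈ Df) (hAx' : A x' ∈ Dg) :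
    {xs : X →L[ℝ] ℝ | ∀ x ∈ Df, A x ∈ Dg → xs (x - x') ≤ f x + g (A x) - (f x' + g (A x'))} =
      {xs : X →L[ℝ] ℝ | ∀ x ∈ Df, xs (x - x') ≤ f x - f x'} +
        (fun ys : Y →L[ℝ] ℝ => ys.comp A) ''
          {ys : Y →L[ℝ] ℝ | ∀ y ∈ Dg, ys (y - A x') ≤ g y - g (A x')} := by
  ext xs
  constructor
  · intro hxs
    obtain ⟨ys, hys, h⟩ := subdiff_sum_rule hf hg A hx₀ hDg hgc hx' hAx' hxs
    exact ⟨xs - ys.comp A, h, ys.comp A, ⟨ys, hys, rfl⟩, sub_add_cancel _ _⟩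
  · rintro ⟨xs₁, h₁, _, ⟨ys, h₂, rfl⟩, rfl⟩
    exact subdiff_add_comp_subset A h₁ h₂

end Decoupling

section Consequences

variable {f : X → ℝ} {Df : Set X}

/-- **Theorem 4.3.4 (Normals to an Intersection)** (= Exercise 4.3.6), interior-point version: for
convex `C₁, C₂ ⊆ X` with `C₁ ∩ int C₂ ≠ ∅` and `x̄ ∈ C₁ ∩ C₂`,
`N(C₁ ∩ C₂; x̄) = N(C₁; x̄) + N(C₂; x̄)`, the normal cones being the sets of functionals
`{x* | ⟨x*, c − x̄⟩ ≤ 0 for all c}` and `+` the pointwise sum of sets.  From the sum rule applied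
to the indicator functions `ι_{C₁} + ι_{C₂}`.
[cite: BorweinZhu2005, Thm 4.3.4 p. 130 & Exercise 4.3.6 p. 133] -/
theorem normalCone_inter {C₁ C₂ : Set X} (hC₁ : Convex ℝ C₁) (hC₂ : Convex ℝ C₂) {x' : X}
    (h₁ : x' ∈ C₁) (h₂ : x' ∈ C₂) (hq : (C₁ ∩ interior C₂).Nonempty) :
    {xs : X →L[ℝ] ℝ | ∀ c ∈ C₁ ∩ C₂, xs (c - x') ≤ 0} =
      {xs : X →L[ℝ] ℝ | ∀ c ∈ C₁, xs (c - x') ≤ 0} +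
        {xs : X →L[ℝ] ℝ | ∀ c ∈ C₂, xs (c - x') ≤ 0} := by
  ext xs
  constructor
  · intro hxs
    obtain ⟨x₀, hx₀, hx₀'⟩ := hq
    obtain ⟨ys, hys, hxs'⟩ := subdiff_sum_rule (convexOn_const (0 : ℝ) hC₁)
      (convexOn_const (0 : ℝ) hC₂) (ContinuousLinearMap.id ℝ X) hx₀
      (by simpa using mem_interior_iff_mem_nhds.1 hx₀') continuousAt_const h₁ (by simpa using h₂)
      (xs := xs) (fun x hx hx2 => by simpa using hxs x ⟨hx, by simpa using hx2⟩)
    refine ⟨xs - ys, fun c hc => ?_, ys, fun c hc => ?_, sub_add_cancel xs ys⟩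
    · simpa using hxs' c hc
    · simpa using hys c (by simpa using hc)
  · rintro ⟨a, ha, b, hb, rfl⟩ c ⟨hc₁, hc₂⟩
    simp only [add_apply]
    linarith [ha c hc₁, hb c hc₂]

/-- **Theorem 4.3.6 (Pshenichnii–Rockafellar)**, first assertion, under the qualification
`int C ∩ dom f ≠ ∅`: if `f` is convex and bounded below by `p` on the convex set `C`, there is an
affine function `α = ⟨x*, ·⟩ + r ≤ f` (on `dom f`) with `α ≥ p` on `C`; for `p = inf_C f` this
says `inf_C α = inf_C f`.  From the sandwich theorem with `g = ι_C − p`.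
[cite: BorweinZhu2005, Thm 4.3.6 p. 131 & Exercise 4.3.7 p. 133] -/
theorem exists_affine_minorant_of_mem_nhds (hf : ConvexOn ℝ Df f) {C : Set X} (hC : Convex ℝ C)
    {x₀ : X} (hx₀ : x₀ ∈ Df) (hCx₀ : C ∈ 𝓝 x₀) {p : ℝ} (hp : ∀ c ∈ C, c ∈ Df → p ≤ f c) :
    ∃ (xs : X →L[ℝ] ℝ) (r : ℝ), (∀ x ∈ Df, xs x + r ≤ f x) ∧ ∀ c ∈ C, p ≤ xs c + r := by
  obtain ⟨ys, r, h1, h2, -⟩ := sandwich hf (convexOn_const (-p) hC) (ContinuousLinearMap.id ℝ X)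
    hx₀ (by simpa using hCx₀) continuousAt_const
    (fun x hx hxC => by simpa using hp x (by simpa using hxC) hx)
  refine ⟨ys, r, fun x hx => by simpa using h1 x hx, fun c hc => ?_⟩
  have := h2 c (by simpa using hc)
  simp only [neg_neg, ContinuousLinearMap.coe_id', id_eq] at this
  exact this

/-- **Theorem 4.3.6 (Pshenichnii–Rockafellar)**, first assertion, under the qualification
`C ∩ cont f ≠ ∅` (the sandwich theorem with the roles of the two functions exchanged).
[cite: BorweinZhu2005, Thm 4.3.6 p. 131 & Exercise 4.3.7 p. 133] -/
theorem exists_affine_minorant_of_continuousAt (hf : ConvexOn ℝ Df f) {C : Set X}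
    (hC : Convex ℝ C) {x₀ : X} (hx₀C : x₀ ∈ C) (hDf : Df ∈ 𝓝 x₀) (hfc : ContinuousAt f x₀)
    {p : ℝ} (hp : ∀ c ∈ C, c ∈ Df → p ≤ f c) :
    ∃ (xs : X →L[ℝ] ℝ) (r : ℝ), (∀ x ∈ Df, xs x + r ≤ f x) ∧ ∀ c ∈ C, p ≤ xs c + r := by
  obtain ⟨ys, r, h1, h2, -⟩ := sandwich (convexOn_const (-p) hC) hf (ContinuousLinearMap.id ℝ X)
    hx₀C (by simpa using hDf) (by simpa using hfc)
    (fun x hxC hxD => by simpa using hp x hxC (by simpa using hxD))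
  refine ⟨-ys, -r, fun x hx => ?_, fun c hc => ?_⟩
  · have := h2 x (by simpa using hx)
    simp only [ContinuousLinearMap.coe_id', id_eq] at this
    simp only [neg_apply]
    linarith
  · have := h1 c hc
    simp only [ContinuousLinearMap.coe_id', id_eq] at this
    simp only [neg_apply]
    linarith

/-- **Theorem 4.3.6**, optimality condition, sufficiency (no qualification needed): if some
`x* ∈ ∂f(x̄)` has `−x* ∈ N(C; x̄)` — i.e. `0 ∈ ∂f(x̄) + N(C; x̄)` — then `x̄` minimises `f` over
`C`. [cite: BorweinZhu2005, Thm 4.3.6 p. 131] -/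
theorem isMinOn_of_subgradient {C : Set X} {x' : X} {xs : X →L[ℝ] ℝ}
    (hxs : ∀ x ∈ Df, xs (x - x') ≤ f x - f x') (hN : ∀ c ∈ C, -(xs (c - x')) ≤ 0) :
    ∀ c ∈ C, c ∈ Df → f x' ≤ f c := by
  intro c hcC hcD
  linarith [hxs c hcD, hN c hcC]

/-- **Theorem 4.3.6 (Pshenichnii–Rockafellar)**, optimality condition, necessity under
`int C ∩ dom f ≠ ∅`: if `x̄ ∈ C ∩ dom f` solves `CP` then `0 ∈ ∂f(x̄) + N(C; x̄)`, i.e. some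
`x* ∈ ∂f(x̄)` has `−x* ∈ N(C; x̄)`.  From the sum rule for `f + ι_C`.
[cite: BorweinZhu2005, Thm 4.3.6 p. 131 & Exercise 4.3.7 p. 133] -/
theorem exists_subgradient_of_isMinOn_of_mem_nhds (hf : ConvexOn ℝ Df f) {C : Set X}
    (hC : Convex ℝ C) {x₀ : X} (hx₀ : x₀ ∈ Df) (hCx₀ : C ∈ 𝓝 x₀) {x' : X} (hx'C : x' ∈ C)
    (hx'D : x' ∈ Df) (hmin : ∀ c ∈ C, c ∈ Df → f x' ≤ f c) :
    ∃ xs : X →L[ℝ] ℝ, (∀ x ∈ Df, xs (x - x') ≤ f x - f x') ∧ ∀ c ∈ C, -(xs (c - x')) ≤ 0 := by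
  obtain ⟨ys, hys, h⟩ := subdiff_sum_rule hf (convexOn_const (0 : ℝ) hC)
    (ContinuousLinearMap.id ℝ X) hx₀ (by simpa using hCx₀) continuousAt_const hx'D
    (by simpa using hx'C) (xs := 0)
    (fun x hx hxC => by simpa using hmin x (by simpa using hxC) hx)
  refine ⟨-ys, fun x hx => ?_, fun c hc => ?_⟩
  · simpa using h x hx
  · simpa using hys c (by simpa using hc)

/-- **Theorem 4.3.6 (Pshenichnii–Rockafellar)**, optimality condition, necessity under
`C ∩ cont f ≠ ∅`. [cite: BorweinZhu2005, Thm 4.3.6 p. 131 & Exercise 4.3.7 p. 133] -/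
theorem exists_subgradient_of_isMinOn_of_continuousAt (hf : ConvexOn ℝ Df f) {C : Set X}
    (hC : Convex ℝ C) {x₀ : X} (hx₀C : x₀ ∈ C) (hDf : Df ∈ 𝓝 x₀) (hfc : ContinuousAt f x₀)
    {x' : X} (hx'C : x' ∈ C) (hx'D : x' ∈ Df) (hmin : ∀ c ∈ C, c ∈ Df → f x' ≤ f c) :
    ∃ xs : X →L[ℝ] ℝ, (∀ x ∈ Df, xs (x - x') ≤ f x - f x') ∧ ∀ c ∈ C, -(xs (c - x')) ≤ 0 := by
  obtain ⟨ys, hys, h⟩ := subdiff_sum_rule (convexOn_const (0 : ℝ) hC) hf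
    (ContinuousLinearMap.id ℝ X) hx₀C (by simpa using hDf) (by simpa using hfc) hx'C
    (by simpa using hx'D) (xs := 0)
    (fun x hxC hxD => by simpa using hmin x hxC (by simpa using hxD))
  refine ⟨ys, fun x hx => ?_, fun c hc => ?_⟩
  · simpa using hys x (by simpa using hx)
  · simpa using h c hc

/-- **Theorem 4.3.7 (Hahn–Banach Extension)**, deduced from the sandwich theorem
(= Exercise 4.3.9): a linear functional `h` on a subspace `L`, dominated there by a continuous
sublinear `p : X → ℝ`, extends to some `x* ∈ X*` dominated by `p` on all of `X`.  (Apply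
Theorem 4.3.2 to `−h + ι_L` and `p`, the roles exchanged so that (4.3.2) holds.)
[cite: BorweinZhu2005, Thm 4.3.7 p. 132 & Exercise 4.3.9 p. 133] -/
theorem hahnBanach_of_sandwich {p : X → ℝ} (hadd : ∀ x y, p (x + y) ≤ p x + p y)
    (hsmul : ∀ (t : ℝ) (x : X), 0 ≤ t → p (t • x) = t * p x) (hpc : Continuous p)
    (L : Submodule ℝ X) (h : L →ₗ[ℝ] ℝ) (hdom : ∀ x : L, h x ≤ p x) :
    ∃ xs : X →L[ℝ] ℝ, (∀ x, xs x ≤ p x) ∧ ∀ x : L, xs x = h x := by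
  classical
  have hp0 : p 0 = 0 := by simpa using hsmul 0 0 le_rfl
  have hpconv : ConvexOn ℝ univ p := by
    refine ⟨convex_univ, fun x _ y _ a b ha hb _ => ?_⟩
    calc p (a • x + b • y) ≤ p (a • x) + p (b • y) := hadd _ _
      _ = a • p x + b • p y := by rw [hsmul a x ha, hsmul b y hb]; rfl
  -- `-h` extended by `0` off `L` (values off `L` are irrelevant)
  set F : X → ℝ := fun x => if hx : x ∈ L then -h ⟨x, hx⟩ else 0 with hF_def
  have hF : ∀ (x : X) (hx : x ∈ L), F x = -h ⟨x, hx⟩ := fun x hx => by simp [hF_def, hx]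
  have hFc : ConvexOn ℝ (L : Set X) F := by
    refine ⟨L.convex, fun x hx y hy a b ha hb hab => ?_⟩
    have hxy : a • x + b • y ∈ L := L.add_mem (L.smul_mem a hx) (L.smul_mem b hy)
    rw [hF _ hxy, hF x hx, hF y hy]
    have : (⟨a • x + b • y, hxy⟩ : L) = a • (⟨x, hx⟩ : L) + b • (⟨y, hy⟩ : L) := rfl
    rw [this, map_add, map_smul, map_smul]
    simp only [smul_eq_mul]
    linarith
  obtain ⟨ys, r, h1, h2, -⟩ := sandwich hFc hpconv (ContinuousLinearMap.id ℝ X) (x₀ := 0)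
    L.zero_mem (by simp) hpc.continuousAt
    (fun x hx _ => by
      have := hdom ⟨x, hx⟩
      rw [hF x hx]
      simpa using this)
  have h00 : h ⟨0, L.zero_mem⟩ = 0 := by
    rw [show (⟨0, L.zero_mem⟩ : L) = 0 from rfl, map_zero]
  have hr0 : r = 0 := by
    have a1 := h1 0 L.zero_mem
    have a2 := h2 0 (mem_univ _)
    rw [hF 0 L.zero_mem, h00] at a1
    simp only [map_zero, zero_add, neg_zero, hp0] at a1 a2
    linarith
  refine ⟨-ys, fun z => ?_, fun x => ?_⟩
  · have := h2 z (mem_univ _)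
    simp only [ContinuousLinearMap.coe_id', id_eq, hr0, add_zero] at this
    simp only [neg_apply]
    linarith
  · have a1 := h1 x x.2
    have a2 := h1 (-(x : X)) (L.neg_mem x.2)
    rw [hF _ x.2] at a1
    rw [hF _ (L.neg_mem x.2)] at a2
    have e1 : (⟨(x : X), x.2⟩ : L) = x := rfl
    have e2 : (⟨-(x : X), L.neg_mem x.2⟩ : L) = -x := rfl
    rw [e1] at a1
    rw [e2, map_neg] at a2
    simp only [ContinuousLinearMap.coe_id', id_eq, map_neg, hr0, add_zero, neg_neg] at a1 a2
    simp only [neg_apply]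
    linarith

/-- **Theorem 4.3.8 (Separation Theorem)** (= Exercise 4.3.10): if `C₁, C₂ ⊆ X` are convex,
`int C₁ ≠ ∅`, `C₂ ≠ ∅` and `C₂ ∩ int C₁ = ∅`, then a non-zero `x* ∈ X*` and `u ∈ ℝ` satisfy
`sup_{C₁} x* ≤ u ≤ inf_{C₂} x*`.  (Proved here directly from Mathlib's geometric Hahn–Banach
theorem; see the module docstring, (vii).)
[cite: BorweinZhu2005, Thm 4.3.8 p. 132 & Exercise 4.3.10 p. 133] -/
theorem separation {C₁ C₂ : Set X} (hC₁ : Convex ℝ C₁) (hC₂ : Convex ℝ C₂)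
    (hint : (interior C₁).Nonempty) (hne : C₂.Nonempty) (hdisj : Disjoint C₂ (interior C₁)) :
    ∃ xs : X →L[ℝ] ℝ, xs ≠ 0 ∧ ∃ u : ℝ, (∀ c ∈ C₁, xs c ≤ u) ∧ ∀ c ∈ C₂, u ≤ xs c := by
  obtain ⟨φ, u, hφ1, hφ2⟩ :=
    geometric_hahn_banach_open hC₁.interior isOpen_interior hC₂ hdisj.symm
  obtain ⟨a₀, ha₀⟩ := hint
  obtain ⟨b₀, hb₀⟩ := hne
  refine ⟨φ, fun h0 => ?_, u, fun c hc => ?_, hφ2⟩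
  · have e1 := hφ1 a₀ ha₀
    have e2 := hφ2 b₀ hb₀
    rw [h0, zero_apply] at e1 e2
    linarith
  · have hcl : c ∈ closure (interior C₁) := by
      rw [hC₁.closure_interior_eq_closure_of_nonempty_interior ⟨a₀, ha₀⟩]
      exact subset_closure hc
    exact closure_minimal (t := {a | φ a ≤ u}) (fun a ha => (hφ1 a ha).le)
      (isClosed_le φ.continuous continuous_const) hcl

/-- **Exercise 4.3.12 (i) (Failure of Convex Calculus)**: for the convex functions `f(x) = −√x`
(`x ≥ 0`, `+∞` otherwise) and `g = ι_{(−∞, 0]}` on `ℝ` one has `dom f ∩ dom g = {0}`, so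
`0 ∈ ∂(f + g)(0)`, while `∂f(0) = ∅` (the example following Corollary 4.2.9); hence
`∂f(0) + ∂g(0) = ∅ ≠ ∂(f + g)(0)` — the qualification (4.3.2) fails here.
[cite: BorweinZhu2005, Exercise 4.3.12 (i) p. 133] -/
theorem sum_rule_fails_without_qualification :
    ConvexOn ℝ (Ici (0 : ℝ)) (fun x : ℝ => -√x) ∧ ConvexOn ℝ (Iic (0 : ℝ)) (fun _ : ℝ => (0 : ℝ)) ∧
      (∀ x ∈ Ici (0 : ℝ), x ∈ Iic (0 : ℝ) →
        (0 : ℝ →L[ℝ] ℝ) (x - 0) ≤ (-√x + 0) - (-√0 + 0)) ∧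
      ¬ ∃ xs : ℝ →L[ℝ] ℝ, ∀ x ∈ Ici (0 : ℝ), xs (x - 0) ≤ -√x - -√0 := by
  refine ⟨Real.strictConcaveOn_sqrt.concaveOn.neg, convexOn_const _ (convex_Iic _), ?_, ?_⟩
  · intro x hx hx'
    have : x = 0 := le_antisymm hx' hx
    subst this
    simp
  · rintro ⟨xs, hxs⟩
    have hlin : ∀ x : ℝ, xs x = x * xs 1 := fun x => by simpa using xs.map_smul x (1 : ℝ)
    have h1 := hxs 1 (by simp)
    norm_num at h1
    have ha : xs 1 < 0 := by linarith
    set a : ℝ := xs 1 with ha_def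
    set t : ℝ := -1 / (2 * a) with ht
    have htpos : 0 < t := div_pos_of_neg_of_neg (by norm_num) (by linarith)
    have h2 := hxs (t ^ 2) (mem_Ici.2 (by positivity))
    rw [sub_zero, Real.sqrt_sq htpos.le, Real.sqrt_zero, neg_zero, sub_zero, hlin] at h2
    have h3 : t * a ≤ -1 := by
      by_contra hh
      push Not at hh
      have := mul_lt_mul_of_pos_left hh htpos
      nlinarith
    have ha0 : a ≠ 0 := ha.ne
    have h4 : t * a = -1 / 2 := by
      rw [ht]
      field_simp
    linarith

end Consequences

end Literature.Analysis.Convex.ConvexSandwichTheorem
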